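import Summits.Ventures.QEC.Census.CertCheck
import HarnessLib

/-!
# Distance certificate DATA for the census row `2bga-g28-A0.1.2.3-B0.1.6.15` (family GB) as `TB_g28_A0_1_2_3_B0_1_6_15.cert` — emitted by qec-type-07 (07.MITMK)

Source certificate: `cert/search-8/j265978/2bga-g28-A0.1.2.3-B0.1.6.15.certA.json` — kernel A, id (sha256) `08e3895c70ababc4181569dad52fbb595cebe1f4902da17c66b9ec28b7e82ed0` (`certA=08e3895c70ababc4`),
lower-bound methods mitm (Z) / mitm (X) as RUN BY KERNEL A; here only its matrices,
upper witnesses and allow-lists are data — the lower bound is RE-ESTABLISHED in the kernel by the meet-in-the-middle lane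
`Census/CertMitmK.lean` (sibling files `MitmKZ*.lean` — Z side; the X side by the kernel X↔Z swap of `Census/CertCheckXZSwap.lean`), the row theorem is `GB/TB_g28_A0_1_2_3_B0_1_6_15/Distance.lean`.
Code: n = 56, 28 X-checks, 28 Z-checks; construction {"type": "explicit"}; generators
`/work/gens/q/2bga-g28-A0.1.2.3-B0.1.6.15.json` (matrix_sha256 `7d4a1e79a16871c49ff4540fe7479e9af55353e0a24a069cefbfb4ffff2eed68`); claimed (n, k, dZ, dX) =
(56, 6, 8, 8) — a CLAIM of the certificate until the sibling theorems;
printed/third-party value: none — a census-discovered code (no parameters for it are claimed in print; any TABLE `d_printed` entry is a census/third-method comparator, wording qec-lead's).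
Allow-lists (`found`): side Z: the certificate's 0 words verbatim; side X: the certificate's list verbatim (not used: the X side follows by the kernel X↔Z swap, `Distance.lean`).
Format = qec-search-7's `emit_lean.py` (`Census/<F>/<Code>/Cert.lean` convention: supports as binary numerals, bit `j` =
qubit `j` of the gens file, identity layout). This file is DATA: no theorem, no `decide`. Generated 2026-08-27T12:37Z by
HOME/census/type-07/emit_mitmk.py; do not edit by hand — re-emit.
-/

namespace Summit.Ventures.QEC.Census.TB_g28_A0_1_2_3_B0_1_6_15

/-- The distance certificate of `TB_g28_A0_1_2_3_B0_1_6_15` as a `DistCert` literal (CERT-FORMAT v1 kernel fields; certificate id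
`08e3895c70ababc4`): `n = 56`, `HX`/`HZ` = the 28 + 28 check rows (words as binary numerals (bit `j` = qubit `j`)), side Z =
(d := 8, weight-8 Z-logical witness, its non-membership witness, allow-list of 0 stabilizer words with
their row decompositions), side X likewise (d := 8, 0 words). -/
def cert : DistCert where
  n := 56
  HX := [
    8814078197775, 17628156395550, 35256312791100, 70512625582200, 141025251164400, 282050502328800,
    564101004657600, 1128202009315200, 2256404018630400, 4512808037260800, 9025616074521600, 18051232149043200,
    36102464298086400, 147334826680320, 294669653360640, 589339306721280, 1178678613442560, 2357357226885120,
    4714714453770240, 9429428907540480, 18858857815080960, 37717715630161920, 3377837490831360, 6755674981662720,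
    13511349963325440, 27022699658215425, 54045399047995395, 36033204058062855]
  HZ := [
    63050395190042625, 54043196342157315, 36028798914822150, 4060151820, 8120303640, 16240607280,
    32212779105, 64425558210, 128851116420, 257702232840, 515404465680, 1030808931360,
    2061617862720, 4123235725440, 8246471450880, 16492674466305, 32985348932610, 65970697865220,
    131941395730440, 263882791460880, 527765582921760, 1055531165843520, 2111062331687040, 4222124663374080,
    8444249326748160, 16888498653496320, 33776997306992640, 67553994613985280]
  sideZ := { d := 8, witness := 8696889386, nonmember := 766499341,
             found := [] }
  sideX := { d := 8, witness := 70506720527434, nonmember := 53687091,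
             found := [] }

end Summit.Ventures.QEC.Census.TB_g28_A0_1_2_3_B0_1_6_15
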